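import Literature.NumberTheory.Automorphic.IwasawaHaarGL2
import Literature.NumberTheory.Automorphic.GLnIwasawaIntegration
import HarnessLib

/-!
# Haar measure on `GL₂(𝔸_K)` in Iwasawa coordinates, `K · N · A` and `K · A · N` orders
(Gelbart, *Automorphic forms on adele groups* (1975), (8.7)–(8.11): `dx = c e^{-2t} dn da dt dk`
for `x = n a h_t k`; here read through `x ↦ x⁻¹` for the RIGHT quotients `G(𝔸) ⧸ A_G Γ` of the tree)

Topic `NumberTheory/Automorphic`; theorems only. `IwasawaHaarGL2.lintegral_eq_iwasawa` writes the
Haar integral of `G = GL₂(𝔸_K)` as `c ∫∫∫∫ f(d(a₁,a₂) u k)` (order `A · N · K`). The automorphic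
quotient of the tree is the RIGHT coset space `G ⧸ A_G GL₂(K)`, and the cusp unfoldings of the
parabolic terms of the trace formula (Gelbart §9.5–9.6) quotient by `A_G B(K)` acting on the
RIGHT; the adapted coordinates have `K` on the LEFT. Since `G` is unimodular, `K` compact and
`N₂(𝔸_K)`, `𝔸_Kˣ` abelian, all four Haar measures are inversion invariant and `x ↦ x⁻¹` turns
`A N K` into `K N A`:

* `upperUnitriangular_two_mul_comm`, `isMulRightInvariant_of_upperUnitriangular_two` — `N₂` is
  abelian, so its left Haar measures are right invariant (hence inversion invariant);
* `lintegral_eq_iwasawa_kna` — **`∫_G f dμ_G = c ∫_{a₁} ∫_{a₂} ∫_u ∫_k f(k u d(a₁,a₂))`**;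
* `lintegral_eq_iwasawa_kan` — **`∫_G f dμ_G = c ∫_{a₁} ∫_{a₂} Δ(a₁ a₂⁻¹) ∫_u ∫_k f(k d(a₁,a₂) u)`**,
  `Δ` the module of `𝔸_K` — the Jacobian of `u ↦ d(a)⁻¹ u d(a)`
  (`lintegral_comp_torusConjGL2`), Gelbart's `e^{-2t}` of (8.11) read through `x ↦ x⁻¹`
  (`H(x⁻¹)` for `x⁻¹ = k d(a) u`).

The unimodularity of `GL₂(𝔸_K)` enters as the instance hypothesis `[μ_G.IsMulRightInvariant]`
(a theorem of the tree: `GLn.isMulRightInvariant_of_isHaarMeasure_adelic_holds`).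

## References

* S. Gelbart, *Automorphic forms on adele groups*, Ann. of Math. Studies 83 (1975), (8.7)–(8.11)
  [Gelbart1975].
* D. Bump, *Automorphic Forms and Representations* (1997), §3.8 [Bump1997].
-/

noncomputable section

open MeasureTheory Measure NumberField IsDedekindDomain Matrix Set Filter
open scoped MatrixGroups ENNReal NNReal Pointwise Topology

namespace Literature.NumberTheory.Automorphic

/-! ### `N₂` is abelian -/

section Unipotent

variable {R : Type*} [CommRing R]

/-- `N₂(R)` is abelian: `n(x) n(y) = n(x + y) = n(y) n(x)`. [folklore] -/
theorem upperUnitriangular_two_mul_comm (u v : ↥(upperUnitriangular (Fin 2) R)) : u * v = v * u := by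
  rw [← unipotentGL2_entry u, ← unipotentGL2_entry v, ← unipotentGL2_add, ← unipotentGL2_add, add_comm]

/-- A left invariant measure on the abelian `N₂(R)` is right invariant. [folklore] -/
theorem isMulRightInvariant_of_upperUnitriangular_two [TopologicalSpace R]
    [MeasurableSpace ↥(upperUnitriangular (Fin 2) R)]
    (ν : Measure ↥(upperUnitriangular (Fin 2) R)) [ν.IsMulLeftInvariant] : ν.IsMulRightInvariant := by
  refine ⟨fun g => ?_⟩
  have h : (fun u : ↥(upperUnitriangular (Fin 2) R) => u * g) = fun u => g * u :=
    funext fun u => upperUnitriangular_two_mul_comm u g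
  rw [h]
  exact map_mul_left_eq_self ν g

end Unipotent

/-! ### The `K · N · A` and `K · A · N` forms -/

section Adelic

variable (K : Type) [Field K] [NumberField K]
  [MeasurableSpace (GL (Fin 2) (AdeleRing (𝓞 K) K))] [BorelSpace (GL (Fin 2) (AdeleRing (𝓞 K) K))]
  [MeasurableSpace (AdeleRing (𝓞 K) K)ˣ] [BorelSpace (AdeleRing (𝓞 K) K)ˣ]
  (μI : Measure (AdeleRing (𝓞 K) K)ˣ) [IsHaarMeasure μI]
  (ν : Measure ↥(adelicUnipotent 2 K)) [IsHaarMeasure ν]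

/-- **Iwasawa coordinates, `K · N · A` order**: for Borel `f ≥ 0` on the unimodular `GL₂(𝔸_K)`,
`∫_G f dμ_G = c ∫_{a₁} ∫_{a₂} ∫_u ∫_k f(k u d(a₁,a₂)) dμ_K dν dμ_I dμ_I`, `c = iwasawaConstGL2`
(`lintegral_eq_iwasawa` read through `x ↦ x⁻¹`; all four Haar measures are inversion invariant).
[cite: Gelbart1975, (8.7)] -/
theorem lintegral_eq_iwasawa_kna (μG : Measure (GL (Fin 2) (AdeleRing (𝓞 K) K))) [IsHaarMeasure μG]
    [μG.IsMulRightInvariant]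
    (μK : Measure ↥(standardMaximalCompactGL 2 K)) [IsHaarMeasure μK]
    {f : GL (Fin 2) (AdeleRing (𝓞 K) K) → ℝ≥0∞} (hf : Measurable f) :
    ∫⁻ g, f g ∂μG = (iwasawaConstGL2 K μI ν μG μK : ℝ≥0∞) *
      ∫⁻ a₁, ∫⁻ a₂, ∫⁻ u, ∫⁻ k, f ((k : GL (Fin 2) (AdeleRing (𝓞 K) K)) *
        (u : GL (Fin 2) (AdeleRing (𝓞 K) K)) * diagGL2 a₁ a₂) ∂μK ∂ν ∂μI ∂μI := by
  obtain ⟨_, _, _⟩ := topology_gl2_adele K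
  haveI : T2Space (AdeleRing (𝓞 K) K) := t2Space_adeleRing K
  haveI := locallyCompactSpace_ideleGroup K
  haveI := secondCountableTopology_ideleGroup K
  haveI : CompactSpace ↥(standardMaximalCompactGL 2 K) :=
    isCompact_iff_compactSpace.1 (isCompact_standardMaximalCompactGL 2 K)
  haveI : SecondCountableTopology ↥(standardMaximalCompactGL 2 K) :=
    TopologicalSpace.Subtype.secondCountableTopology _
  haveI := isInvInvariant_of_compactSpace μK
  haveI : μG.IsInvInvariant := isInvInvariant_of_isMulRightInvariant μG
  haveI : μI.Regular := by infer_instance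
  haveI : μI.IsInvInvariant := by infer_instance
  haveI : ν.IsMulRightInvariant := isMulRightInvariant_of_upperUnitriangular_two ν
  haveI : SecondCountableTopology ↥(adelicUnipotent 2 K) :=
    TopologicalSpace.Subtype.secondCountableTopology _
  haveI : LocallyCompactSpace ↥(adelicUnipotent 2 K) :=
    (isClosed_upperUnitriangular (n := 2) (R := AdeleRing (𝓞 K) K)).isClosedEmbedding_subtypeVal
      |>.locallyCompactSpace
  haveI : ν.IsInvInvariant := isInvInvariant_of_isMulRightInvariant ν
  -- `∫ f = ∫ f(g⁻¹)`, then `lintegral_eq_iwasawa` for `f ∘ inv`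
  have h := lintegral_eq_iwasawa K μI ν μG μK (hf.comp measurable_inv)
  simp only [Function.comp_def] at h
  rw [← lintegral_inv_eq_self (μ := μG) f, h]
  congr 1
  -- invert each coordinate
  rw [← lintegral_inv_eq_self (μ := μI)]
  refine lintegral_congr fun a₁ => ?_
  rw [← lintegral_inv_eq_self (μ := μI)]
  refine lintegral_congr fun a₂ => ?_
  rw [← lintegral_inv_eq_self (μ := ν)]
  refine lintegral_congr fun u => ?_
  rw [← lintegral_inv_eq_self (μ := μK)]
  refine lintegral_congr fun k => ?_
  simp only [_root_.mul_inv_rev, Subgroup.coe_inv, inv_inv, diagGL2_inv, mul_assoc]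

variable [MeasurableSpace (AdeleRing (𝓞 K) K)] [BorelSpace (AdeleRing (𝓞 K) K)]
  [LocallyCompactSpace (AdeleRing (𝓞 K) K)]

/-- **Iwasawa coordinates, `K · A · N` order, with the modular factor**: for Borel `f ≥ 0`,
`∫_G f dμ_G = c ∫_{a₁} ∫_{a₂} Δ(a₁ a₂⁻¹) ∫_u ∫_k f(k d(a₁,a₂) u) dμ_K dν dμ_I dμ_I`, `Δ` the module
of `𝔸_K` — Gelbart's `dx = c e^{-2t} dn da dt dk` for `x = n a h_t k`, read through `x ↦ x⁻¹`.
[cite: Gelbart1975, (8.11)] -/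
theorem lintegral_eq_iwasawa_kan (μG : Measure (GL (Fin 2) (AdeleRing (𝓞 K) K))) [IsHaarMeasure μG]
    [μG.IsMulRightInvariant]
    (μK : Measure ↥(standardMaximalCompactGL 2 K)) [IsHaarMeasure μK]
    {f : GL (Fin 2) (AdeleRing (𝓞 K) K) → ℝ≥0∞} (hf : Measurable f) :
    ∫⁻ g, f g ∂μG = (iwasawaConstGL2 K μI ν μG μK : ℝ≥0∞) *
      ∫⁻ a₁, ∫⁻ a₂, ((distribHaarChar (AdeleRing (𝓞 K) K) (a₁ * a₂⁻¹) : ℝ≥0) : ℝ≥0∞) *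
        ∫⁻ u, ∫⁻ k, f ((k : GL (Fin 2) (AdeleRing (𝓞 K) K)) * diagGL2 a₁ a₂ *
          (u : GL (Fin 2) (AdeleRing (𝓞 K) K))) ∂μK ∂ν ∂μI ∂μI := by
  obtain ⟨_, _, _⟩ := topology_gl2_adele K
  haveI : CompactSpace ↥(standardMaximalCompactGL 2 K) :=
    isCompact_iff_compactSpace.1 (isCompact_standardMaximalCompactGL 2 K)
  haveI : IsFiniteMeasure μK := CompactSpace.isFiniteMeasure
  rw [lintegral_eq_iwasawa_kna K μI ν μG μK hf]
  congr 1
  refine lintegral_congr fun a₁ => lintegral_congr fun a₂ => ?_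
  -- `u d(a) = d(a) (d(a)⁻¹ u d(a))`, and the Jacobian of `u ↦ d(a)⁻¹ u d(a)`
  have hF : Measurable fun u : ↥(adelicUnipotent 2 K) =>
      ∫⁻ k, f ((k : GL (Fin 2) (AdeleRing (𝓞 K) K)) * diagGL2 a₁ a₂ *
        (u : GL (Fin 2) (AdeleRing (𝓞 K) K))) ∂μK := by
    refine Measurable.lintegral_prod_left' (f := fun q : ↥(standardMaximalCompactGL 2 K) × ↥(adelicUnipotent 2 K) =>
      f ((q.1 : GL (Fin 2) (AdeleRing (𝓞 K) K)) * diagGL2 a₁ a₂ * (q.2 : GL (Fin 2) (AdeleRing (𝓞 K) K)))) ?_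
    exact hf.comp (((continuous_subtype_val.comp continuous_fst).mul continuous_const).mul
      (continuous_subtype_val.comp continuous_snd)).measurable
  rw [← lintegral_comp_torusConjGL2 K ν (a₁, a₂) hF]
  refine lintegral_congr fun u => lintegral_congr fun k => ?_
  rw [mul_assoc, mul_assoc, diagGL2_mul_torusConjGL2 (a₁, a₂) u]

end Adelic

end Literature.NumberTheory.Automorphic
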